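/-
Copyright (c) 2026 the pub-hodgecm-mathlib formalisation cell (harness21).  Prover seat hodgecm-mathlib-B-p14 (g30), (F11) «ramified torus `(EL)¹ × E¹`» of MAP v3
(architect A-p06 (g26)); LEAD F0P3a-plan (g9) WORDS T8-41, T8-45; LAYER A pattern of A-p03 (g24) ★ `UnitOrbitalIntegralInertSumsThetaOne`, 2026-09-01.
-/
import Literature.NumberTheory.Rogawski1990.UnitOrbitalIntegralInertClosedFormsTypeTwo   -- ★ p840882 (this seat): `phiTH` (Prop. 11, second half)
import Literature.NumberTheory.Rogawski1990.UnitOrbitalIntegralInertSumsThetaOne       -- ★ A-p03 (g24): `iTen`, `innerSumTen`, `innerSumTen_eq_closed`, geometric sums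
import Literature.NumberTheory.Rogawski1990.UnitFundamentalLemmaInertFlickerAlgebraTypeTwo   -- (ED. 2) ★ `phiTHM_succ`, `phiTHM_zero_left` (the `(M,N)` re-indexing)
import HarnessLib

/-!
# Flicker's unit orbital integral on the torus `T_H ≃ (EL)¹ × E¹` — LAYER A: Cor. 9 (`T_H` form) + Prop. 10 (`T_H` clause) ⇒ Prop. 11 (second half)
# (Canad. J. Math. 50 (1998), p. 85 and Prop. 10 p. 85, Prop. 11 p. 87)

Topic `NumberTheory/Rogawski1990` (road «D-N7-inert», MAP v3 brick (F11), line «N7nsCount» stub `stub_countIrredClause`); namespace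
`Literature.NumberTheory.Rogawski1990.Flicker1998`.  KERNEL lane: THEOREMS ONLY (no `def`, no instance, no notation, no named fact, no `sorry`).  Cell
`pub/hodgecm-mathlib`, crux H413 = `stmt-HodgeConjecture-24833`.  The type-(2) twin of ★ `UnitOrbitalIntegralInertSumsThetaOne` (A-p03: Cor. 9 + Prop. 10 ⇒ Prop. 11
first half = `phiOne`).

THE MATHEMATICS [Flicker1998UnitaryFL, p. 85].  For a regular `t ∈ T_H ⊂ H` (torus `(EL)¹ × E¹`, invariants `N` (`α = Bπ^N`), `N₂` (`δ₂ = D₂π^{1+N₂}`)) the orbital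
integral unfolds over `H = ⊔_{j ≥ 0} T_H r_j K_H` (Prop. 6, second half; index `[R_L¹ : R_L(j)¹] = q^j`, Prop. 7 — ★ (F3b) `RamifiedQuadraticOrderUnitIndex`) and
`G = ⊔_{m ≥ 0} H u_m K` (Prop. 4, ★ (F1)) as
  `∫_{T_H∖G} 1_K(x⁻¹tx) dx = Σ_{j ≥ 0} q^j Σ_{m ≥ 0} ∫_{P_H∕(H^K_m ∩ P_H)} 1_{H^K_m}(p⁻¹ r_j⁻¹ t r_j p) dp`   (p. 85, all `j`, weight `q^j`),
and Prop. 10's `T_H` CLAUSE gives the inner integral: `1` (`m = 0`), `(1 − q⁻²)q^{4m}` (`1 ≤ m ≤ min([ν∕2],[(1+N₂)∕2])`), `(1 + q⁻¹)q^{ν+2m}`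
(`ν = 1 + N₂ < 2m ≤ 2 + 2N₂`, `N₂ < N`), `0` otherwise, `ν = N − j` — which is EXACTLY A-p03's ★ `iTen q ν N₊ m` at `N₊ := 1 + N₂` (the side condition `N₂ < N`
is automatic: `ν = 1 + N₂ ≤ N`), and the terms with `j > N` vanish.  LAYER A (this file, pure arithmetic): the resulting double sum IS Prop. 11's printed closed form,
  **`Σ_{j=0}^{N} q^j · innerSumTen q (N − j) (1 + N₂) = phiTH q N₂ N`**   (`sum_pow_mul_innerSumTen_eq_phiTH`),
proved through the recurrence `φ_{T_H}(N₂, N+1) = q·φ_{T_H}(N₂, N) + S(N+1)` (`phiTH_succ`; three regimes `N < N₂`, `N = N₂` — the `δ`-tail —, `N₂ < N`, each by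
parity and `field_simp; ring`) and `φ_{T_H}(N₂, 0) = 1`.  Checked beforehand in exact arithmetic (`F0/P3a/B-p14/g30/CHECK-…`: 147 triples, 0 exceptions) — it is
ALSO the decoding certificate of Prop. 10's `T_H` clause and of the `q^j`-weights of p. 85.  LAYER B (the volume statement `∫ … = iTen` for `r_j⁻¹ t r_j`, `t ∈ T_H`)
and LAYER C (the unfolding over ★ (F1)(F2)(F3b)(F3c)) are the remaining inputs of the VALUE `Φ(⟦t⟧, 1_K) = phiTH` ((F11-c), `κ = +1` class).
HONEST LABEL: HC_CM is proved only modulo the printed citations until rung 0 closes; this file asserts nothing about orbital integrals.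

## References
* [Flicker1998UnitaryFL] Y. Z. Flicker, *Elementary proof of the fundamental lemma for a unitary group*, Canad. J. Math. 50 (1998): p. 85 (the `T_H` unfolding),
  Prop. 7 p. 84, Prop. 10 p. 85, Prop. 11 p. 87.
* [Rogawski1990] J. D. Rogawski, *Automorphic Representations of Unitary Groups in Three Variables* (1990), §4.9 Prop. 4.9.1 (b) p. 55.
-/

set_option autoImplicit false

open Finset

namespace Literature.NumberTheory.Rogawski1990.Flicker1998

variable {q : ℕ}

/-! ## §1 The inner sum `S(ν) = innerSumTen q ν (1 + N₂)` in the three regimes -/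

/-- `ν ≤ N₂`: no `δ`-tail, `K = [ν∕2]`. [cite: Flicker1998UnitaryFL, Prop. 10 p. 85] -/
theorem innerSumTen_succ_of_le (hq : 1 < q) {ν N₂ : ℕ} (h : ν ≤ N₂) :
    innerSumTen q ν (1 + N₂) = 1 + (1 - ((q : ℚ) ^ 2)⁻¹) * (((q : ℚ) ^ (4 * (ν / 2 + 1)) - (q : ℚ) ^ 4) / ((q : ℚ) ^ 4 - 1)) := by
  rw [innerSumTen_eq_closed hq, min_eq_left (by omega), if_neg (by omega), add_zero]

/-- `ν = 1 + N₂`: the `δ`-tail is present, `K = [(1+N₂)∕2]`. [cite: Flicker1998UnitaryFL, Prop. 10 p. 85] -/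
theorem innerSumTen_succ_self (hq : 1 < q) (N₂ : ℕ) :
    innerSumTen q (1 + N₂) (1 + N₂) = 1 + (1 - ((q : ℚ) ^ 2)⁻¹) * (((q : ℚ) ^ (4 * ((1 + N₂) / 2 + 1)) - (q : ℚ) ^ 4) / ((q : ℚ) ^ 4 - 1)) +
      (1 + ((q : ℚ))⁻¹) * ((q : ℚ) ^ (1 + N₂) * (((q : ℚ) ^ (2 * (1 + N₂ + 1)) - (q : ℚ) ^ (2 * ((1 + N₂) / 2 + 1))) / ((q : ℚ) ^ 2 - 1))) := by
  rw [innerSumTen_eq_closed hq, min_self, if_pos rfl]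

/-- `1 + N₂ < ν`: no `δ`-tail, `K = [(1+N₂)∕2]`. [cite: Flicker1998UnitaryFL, Prop. 10 p. 85] -/
theorem innerSumTen_succ_of_lt (hq : 1 < q) {ν N₂ : ℕ} (h : 1 + N₂ < ν) :
    innerSumTen q ν (1 + N₂) = 1 + (1 - ((q : ℚ) ^ 2)⁻¹) * (((q : ℚ) ^ (4 * ((1 + N₂) / 2 + 1)) - (q : ℚ) ^ 4) / ((q : ℚ) ^ 4 - 1)) := by
  rw [innerSumTen_eq_closed hq, min_eq_right (Nat.div_le_div_right h.le), if_neg (by omega), add_zero]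

/-! ## §2 The recurrence `φ_{T_H}(N₂, N+1) = q·φ_{T_H}(N₂, N) + S(N+1)` and the initial value -/

/-- `φ_{T_H}(N₂, 0) = 1` (`= S(0)`, the `j = 0`, `m = 0` term). [cite: Flicker1998UnitaryFL, Prop. 11 p. 87] -/
theorem phiTH_zero (hq : 1 < q) (N₂ : ℕ) : phiTH q N₂ 0 = 1 := by
  have h1 := cast_sub_one_ne_zero hq
  have h2 : (q : ℚ) ^ 2 + 1 ≠ 0 := by positivity
  simp only [phiTH, Nat.zero_le, if_true, Nat.zero_mod, zero_ne_one, if_false, mul_zero, zero_add, add_zero]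
  field_simp
  ring

/-- **THE RECURRENCE** `φ_{T_H}(N₂, N+1) = q · φ_{T_H}(N₂, N) + innerSumTen q (N+1) (1+N₂)` — the `T_H` double sum of p. 85 re-indexed by `ν = N − j`
(raising `N` by one multiplies every old weight `q^j` by `q` and adds the new term `j = 0`, `ν = N + 1`).  [cite: Flicker1998UnitaryFL, p. 85; Prop. 11 p. 87] -/
theorem phiTH_succ (hq : 1 < q) (N₂ N : ℕ) : phiTH q N₂ (N + 1) = (q : ℚ) * phiTH q N₂ N + innerSumTen q (N + 1) (1 + N₂) := by
  have h1 := cast_sub_one_ne_zero hq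
  have h2 : (q : ℚ) ^ 2 + 1 ≠ 0 := by positivity
  have h4 := cast_pow_four_sub_one_ne_zero hq
  have hq0 : (q : ℚ) ≠ 0 := by exact_mod_cast (by omega : q ≠ 0)
  have h21 : (q : ℚ) ^ 2 - 1 ≠ 0 := cast_pow_sub_one_ne_zero hq (by norm_num)
  rcases Nat.lt_trichotomy N N₂ with hlt | heq | hgt
  · -- regime `N < N₂`: both `φ` in case (1), no tail
    rw [innerSumTen_succ_of_le hq (by omega : N + 1 ≤ N₂)]
    simp only [phiTH, if_pos (show N + 1 ≤ N₂ by omega), if_pos (show N ≤ N₂ by omega)]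
    obtain ⟨a, rfl | rfl⟩ := Nat.even_or_odd' N
    · have e1 : ¬ (2 * a) % 2 = 1 := by omega
      have e2 : (2 * a + 1) % 2 = 1 := by omega
      have e3 : (2 * a + 1) / 2 = a := by omega
      rw [if_neg e1, if_pos e2, e3]
      field_simp
      ring
    · have e1 : (2 * a + 1) % 2 = 1 := by omega
      have e2 : ¬ (2 * a + 1 + 1) % 2 = 1 := by omega
      have e3 : (2 * a + 1 + 1) / 2 = a + 1 := by omega
      rw [if_pos e1, if_neg e2, e3]
      field_simp
      ring
  · -- regime `N = N₂`: `φ(N)` in case (1), `φ(N+1)` in case (2), the tail present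
    subst heq
    rw [show N + 1 = 1 + N by ring, innerSumTen_succ_self hq]
    simp only [phiTH, if_neg (show ¬ 1 + N ≤ N by omega), if_pos le_rfl]
    obtain ⟨b, rfl | rfl⟩ := Nat.even_or_odd' N
    · have e1 : ¬ (2 * b) % 2 = 1 := by omega
      have e2 : (2 * b) % 2 = 0 := by omega
      have e3 : (1 + 2 * b) / 2 = b := by omega
      rw [if_neg e1, if_pos e2, e3]
      field_simp
      ring
    · have e1 : (2 * b + 1) % 2 = 1 := by omega
      have e2 : ¬ (2 * b + 1) % 2 = 0 := by omega
      have e3 : (1 + (2 * b + 1)) / 2 = b + 1 := by omega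
      rw [if_pos e1, if_neg e2, e3]
      field_simp
      ring
  · -- regime `N₂ < N`: both in case (2), no tail
    rw [innerSumTen_succ_of_lt hq (by omega : 1 + N₂ < N + 1)]
    simp only [phiTH, if_neg (show ¬ N + 1 ≤ N₂ by omega), if_neg (show ¬ N ≤ N₂ by omega)]
    obtain ⟨b, rfl | rfl⟩ := Nat.even_or_odd' N₂
    · have e2 : (2 * b) % 2 = 0 := by omega
      have e3 : (1 + 2 * b) / 2 = b := by omega
      simp only [if_pos e2]
      rw [e3]
      field_simp
      ring
    · have e2 : ¬ (2 * b + 1) % 2 = 0 := by omega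
      have e3 : (1 + (2 * b + 1)) / 2 = b + 1 := by omega
      simp only [if_neg e2]
      rw [e3]
      field_simp
      ring

/-! ## §3 Cor. 9 (`T_H` form) + Prop. 10 (`T_H` clause) ⇒ Prop. 11 (second half) -/

/-- **THE `T_H` DOUBLE SUM IS PROP. 11'S CLOSED FORM** (indexed by `ν = N − j`): `Σ_{ν=0}^{N} q^{N−ν} · innerSumTen q ν (1+N₂) = phiTH q N₂ N`.
[cite: Flicker1998UnitaryFL, p. 85; Prop. 10 p. 85; Prop. 11 p. 87] -/
theorem sum_pow_sub_mul_innerSumTen_eq_phiTH (hq : 1 < q) (N₂ N : ℕ) :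
    ∑ ν ∈ range (N + 1), (q : ℚ) ^ (N - ν) * innerSumTen q ν (1 + N₂) = phiTH q N₂ N := by
  induction N with
  | zero =>
    rw [Finset.sum_range_one, Nat.sub_self, pow_zero, one_mul, phiTH_zero hq, innerSumTen_succ_of_le hq (Nat.zero_le _)]
    simp
  | succ N ih =>
    rw [Finset.sum_range_succ, Nat.sub_self, pow_zero, one_mul, phiTH_succ hq, ← ih, Finset.mul_sum]
    congr 1
    refine Finset.sum_congr rfl fun ν hν => ?_
    rw [Finset.mem_range] at hν
    rw [show N + 1 - ν = (N - ν) + 1 by omega, pow_succ]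
    ring

/-- **COR. 9 (`T_H` FORM) + PROP. 10 (`T_H` CLAUSE) ⇒ PROP. 11 (SECOND HALF)**, in Flicker's indexing: `Σ_{j=0}^{N} q^j · Σ_m I(j, m) = φ_{T_H}(N₂, N)` with
`I(j, m) = iTen q (N − j) (1 + N₂) m` (weight `q^j = [R_L¹ : R_L(j)¹]`; the terms `j > N` of p. 85's sum vanish).  [cite: Flicker1998UnitaryFL, p. 85; Prop. 10 p. 85; Prop. 11 p. 87] -/
theorem sum_pow_mul_innerSumTen_eq_phiTH (hq : 1 < q) (N₂ N : ℕ) :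
    ∑ j ∈ range (N + 1), (q : ℚ) ^ j * innerSumTen q (N - j) (1 + N₂) = phiTH q N₂ N := by
  rw [← sum_pow_sub_mul_innerSumTen_eq_phiTH hq N₂ N, ← Finset.sum_range_reflect]
  refine Finset.sum_congr rfl fun j hj => ?_
  rw [Finset.mem_range] at hj
  rw [show N + 1 - 1 - j = N - j by omega, show N - (N - j) = j by omega]

/-! ## §4 (ED. 2) The `(M, N)`- and `(n, N)`-indexed forms (incl. the boundary stratum `M = 0`), matching the registered value stub `stub_irredGValuePos` -/

/-- On the boundary stratum (`N₊ = M = 0`) only the `m = 0` term of Prop. 10 survives: `innerSumTen q ν 0 = 1`. [cite: Flicker1998UnitaryFL, Prop. 10 p. 85] -/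
theorem innerSumTen_zero_right (q ν : ℕ) : innerSumTen q ν 0 = 1 := by
  unfold innerSumTen
  rw [Finset.sum_eq_single 0]
  · simp [iTen]
  · intro m _ hm
    have h1 : ¬ m ≤ min (ν / 2) (0 / 2) := by omega
    have h2 : ¬ (ν = 0 ∧ ν < 2 * m ∧ m ≤ ν) := by omega
    simp only [iTen, if_neg hm, if_neg h1, if_neg h2]
  · intro h; exact absurd (Finset.mem_range.2 (Nat.zero_lt_succ ν)) h

/-- **THE `T_H` DOUBLE SUM IN THE `(M, N)` INDEXING** (`M = N₊ = N₂ + 1 ≥ 0`): `Σ_{j=0}^{N} q^j · innerSumTen q (N − j) M = phiTHM q M N` — for `M ≥ 1` this is §3 at `N₂ = M − 1`,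
for `M = 0` it is the geometric sum `Σ_{j ≤ N} q^j = (q^{N+1} − 1)∕(q − 1) = Φ_H`.  [cite: Flicker1998UnitaryFL, p. 85; Prop. 10 p. 85; Prop. 11 p. 87] -/
theorem sum_pow_mul_innerSumTen_eq_phiTHM (hq : 1 < q) (M N : ℕ) :
    ∑ j ∈ range (N + 1), (q : ℚ) ^ j * innerSumTen q (N - j) M = phiTHM q M N := by
  rcases M with _ | N₂
  · simp_rw [innerSumTen_zero_right, mul_one]
    have hq1 : (q : ℚ) ≠ 1 := by exact_mod_cast (ne_of_gt hq)
    rw [geom_sum_eq hq1, (phiTHM_zero_left hq N).1, phiHtwo]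
  · rw [phiTHM_succ, ← sum_pow_mul_innerSumTen_eq_phiTH hq N₂ N, Nat.add_comm N₂ 1]

/-- **THE `T_H` DOUBLE SUM IN THE OBSERVABLE INDEXING `(n, N)` of the line's value stub `stub_irredGValuePos`**: with `M := n∕2` (`n` even) resp. `N + 1`
(`n = 2N + 1`), `Σ_{j=0}^{N} q^j · innerSumTen q (N − j) M = phiTHn q n N`.  [cite: Flicker1998UnitaryFL, p. 85; Prop. 11 p. 87; Theorem 18 p. 97] -/
theorem sum_pow_mul_innerSumTen_eq_phiTHn (hq : 1 < q) (n N : ℕ) :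
    ∑ j ∈ range (N + 1), (q : ℚ) ^ j * innerSumTen q (N - j) (if n % 2 = 0 then n / 2 else N + 1) = phiTHn q n N := by
  rw [phiTHn, sum_pow_mul_innerSumTen_eq_phiTHM hq]

/-! ## §5 (ED. 3) LAYER A′ for the `κ = −1` class: Prop. 16's per-`m` table sums to Prop. 17 — `Σᶠ_m iSixteenM q M N m = phiTHprimeM q M N` (all `M`, incl. `M = 0`) -/

/-- Prop. 16's table vanishes beyond `m = N + M`: the `finsum` is a finite sum. [cite: Flicker1998UnitaryFL, Prop. 16 p. 96] -/
theorem iSixteenM_eq_zero_of_lt {q M N m : ℕ} (hm : N + M < m) : iSixteenM q M N m = 0 := by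
  unfold iSixteenM
  rw [if_neg (by omega), if_neg (by omega)]

/-- **PROPOSITION 17 FROM PROPOSITION 16, `(M, N)`-indexed**: `Σᶠ_{m ≥ 0} iSixteenM q M N m = phiTHprimeM q M N` — for `M = N₂ + 1 ≥ 1` this is ★ `phiTHprime_eq_sum`
(the two geometric sums), for `M = 0` both sides vanish.  This is the LAYER-A′ half of the value stub `stub_irredGValueNeg` (`Φ(⟦κ = −1⟧, 1_K) = phiTHprimen`):
with ★ (F2′) `natCard_fixedPoints_unitaryInt_eq_finsum_flickerDiag` only the per-`m` COUNT `#{hH′_m : t′ • hH′_m = hH′_m} = iSixteenM q M N m` (LAYER B′) remains.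
[cite: Flicker1998UnitaryFL, Prop. 16 p. 96; Prop. 17 p. 97] -/
theorem finsum_iSixteenM_eq_phiTHprimeM (hq : 1 < q) (M N : ℕ) : ∑ᶠ m : ℕ, iSixteenM q M N m = phiTHprimeM q M N := by
  -- reduce the `finsum` to a `Finset.sum` over `range (N + M + 1)`
  have hsupp : Function.support (fun m => iSixteenM q M N m) ⊆ ((range (N + M + 1) : Finset ℕ) : Set ℕ) := by
    intro m hm
    rw [Function.mem_support] at hm
    rw [Finset.coe_range, Set.mem_Iio]
    by_contra h
    exact hm (iSixteenM_eq_zero_of_lt (by omega))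
  rw [finsum_eq_sum_of_support_subset _ hsupp]
  rcases M with _ | N₂
  · -- boundary stratum: every term vanishes
    rw [(phiTHM_zero_left hq N).2]
    refine Finset.sum_eq_zero fun m _ => ?_
    unfold iSixteenM
    rw [if_neg (by omega), if_neg (by omega)]
  · -- `M = N₂ + 1`: split the table into Prop. 17's two geometric sums
    rw [phiTHprimeM_succ, phiTHprime_eq_sum hq]
    have hsplit : ∀ m, iSixteenM q (N₂ + 1) N m =
        (if m ∈ range (min (N / 2) (N₂ / 2) + 1) then ((q : ℚ) + 1) * (q : ℚ) ^ (4 * m) else 0) +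
        (if N ≤ N₂ then (if m ∈ Ioc (N / 2) N then ((q : ℚ) + 1) * (q : ℚ) ^ (N + 2 * m) else 0) else 0) := by
      intro m
      unfold iSixteenM
      simp only [Finset.mem_range, Finset.mem_Ioc, Nat.add_sub_cancel, Nat.lt_succ_iff, le_min_iff]
      split_ifs <;> (first | (exfalso; omega) | ring)
    by_cases hN : N ≤ N₂
    · simp_rw [hsplit, if_pos hN]
      rw [Finset.sum_add_distrib, ← Finset.sum_filter, ← Finset.sum_filter]
      congr 1
      · congr 1
        ext m
        simp only [Finset.mem_filter, Finset.mem_range, Nat.lt_succ_iff, le_min_iff]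
        omega
      · congr 1
        ext m
        simp only [Finset.mem_filter, Finset.mem_range, Finset.mem_Ioc]
        omega
    · simp_rw [hsplit, if_neg hN, add_zero]
      rw [← Finset.sum_filter]
      congr 1
      ext m
      simp only [Finset.mem_filter, Finset.mem_range, Nat.lt_succ_iff, le_min_iff]
      omega

end Literature.NumberTheory.Rogawski1990.Flicker1998
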